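import Mathlib
import HarnessLib
import Literature.Probability.LatticeModels.CriticalFKIsingConnectionLaws

/-!
# The thermodynamic limit of the critical FK-Ising connection laws along boxes, with
# connections restricted to prescribed vertex sets ("thinned" open paths)

Topic `Literature/Probability/LatticeModels`. This continues `CriticalFKIsingConnectionLaws`: for the
wired FK-Ising random-cluster measure at `p = 1 - e^{-2β_c(d)}`, `q = 2`, `d ≥ 3`, of the boxes
`Λ_L = box d L` of `ℤ^d` (the barrier file's `boxGraph`/`boxBoundary`, definitionally the general
`finsetGraph`/`wiredBoundary`), and finitely many **connection queries** `i`, each consisting of two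
probe sets `A i, B i ⊆ ℤ^d` (each finite or co-finite) and a vertex set `O i ⊆ ℤ^d`, the query `i`
HOLDS in a configuration `ω` of `Λ_L` iff some `x ∈ A i ∩ Λ_L` and `y ∈ B i ∩ Λ_L` are joined by an
open path of `Λ_L` all of whose edges have both endpoints in `O i` — an open path of the
configuration `ω ∩ {e | e ⊆ O i}` THINNED to `O i`; for `O i = ℤ^d` this is the plain open-path
connection of `CriticalFKIsingConnectionLaws`. We prove that the joint law of the answers converges:

* `finsetRestrict_thin` — thinning commutes with restriction to sub-pieces;
* `rcMeasure_real_ghostThinConnEvent_box_anti` — the ghost-wired thinned connection events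
  (connection by thinned open edges and wired pairs of `∂Λ_L`) are increasing and restrict to
  sub-boxes (`ghostConn_finsetRestrict`, i.e. Grimmett 2006, Lemma (4.13), applied to the thinned
  configuration), hence their probabilities are antitone in `L` (Thm. (4.19)(a), proof, eq. (4.24))
  and converge (`tendsto_rcMeasure_real_ghostThinConnEvent`) — any `0 ≤ p ≤ 1`, `q ≥ 1`, `d ≥ 1`;
* `ghostThinConnEvent_diff_thinConnEvent_subset` — the ghost correction is a finite union of arm
  events of lattice points, which vanish at `β_c(d)`, `d ≥ 3` (`CriticalFKIsingArmVanishes`), so the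
  thinned connection events converge (`tendsto_rcMeasure_real_thinConnEvent_criticalBeta`);
* `tendsto_rcMeasure_real_thinConnAtom_criticalBeta`, `measureReal_thinConnLaw_eq_sum`,
  `tendsto_rcMeasure_real_thinConnLaw_criticalBeta` — atoms by induction on the excluded queries,
  the law as the sum over its atoms; **the law of the answers to finitely many thinned connection
  queries converges as `L → ∞`**.

This is again the finite-volume content of Grimmett 2006, Thm. (4.19) (existence of the wired limit
measure) for these cylinder-like events at `p_c(2)` on `ℤ^d`, `d ≥ 3`, where the wired arm correction
vanishes by `m*(β_c) = 0` (Aizenman–Duminil-Copin–Sidoravicius 2015). Thinned connections express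
"joined outside a given finite region" (e.g. the crossing clusters of an annulus read outside an
inner ball); used by the route `CriticalPhenomena/Ising3DConformalLimit/ArmDressing` (crux
`EvenPatternDecoupling`, the box limits of the pattern events).

## References

* G. Grimmett, *The Random-Cluster Model* (2006), §4.2–4.3, Lemma (4.13), Thm. (4.19) and its
  proof, eq. (4.24). [Grimmett2006]
* M. Aizenman, H. Duminil-Copin, V. Sidoravicius, Comm. Math. Phys. 334 (2015), Thm. 1.2.
  [AizenmanDuminilCopinSidoraviciusCMP2015]

No definitions, no named facts.
-/

namespace Literature.Probability.LatticeModels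

open _root_.MeasureTheory Finset SimpleGraph Filter _root_.Topology
open Literature.Probability.Percolation Literature.Barriers.CriticalPhenomena

variable {d : ℕ}

/-! ### Thinning a configuration to a vertex set -/

section Thin

/-- Membership of a pair in the configuration `ω` of the piece `S` **thinned** to the vertex set
`O ⊆ ℤ^d` (the open edges of `ω` with both endpoints in `O`; the open paths of the thinned
configuration are the open paths of `ω` through vertices of `O`). [folklore] -/
theorem mk_mem_thin_iff {S : Finset (Site d)} {O : Set (Site d)} {ω : BondConfig ↥S} {a b : ↥S} :
    s(a, b) ∈ ω ∩ {e : Sym2 ↥S | ∀ v ∈ e, v.1 ∈ O} ↔ s(a, b) ∈ ω ∧ a.1 ∈ O ∧ b.1 ∈ O := by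
  rw [Set.mem_inter_iff, Set.mem_setOf_eq]
  simp only [Sym2.mem_iff, forall_eq_or_imp, forall_eq]

/-- Thinning to all of `ℤ^d` does nothing. [folklore] -/
theorem thin_univ (S : Finset (Site d)) (ω : BondConfig ↥S) :
    ω ∩ {e : Sym2 ↥S | ∀ v ∈ e, v.1 ∈ (Set.univ : Set (Site d))} = ω := by
  ext e
  simp only [Set.mem_inter_iff, Set.mem_setOf_eq, Set.mem_univ, implies_true, and_true]

/-- **Thinning commutes with restriction to a sub-piece.** [folklore] -/
theorem finsetRestrict_thin {Λ Δ : Finset (Site d)} (h : Λ ⊆ Δ) (O : Set (Site d))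
    (ω : BondConfig ↥Δ) :
    finsetRestrict h (ω ∩ {e : Sym2 ↥Δ | ∀ v ∈ e, v.1 ∈ O}) =
      finsetRestrict h ω ∩ {e : Sym2 ↥Λ | ∀ v ∈ e, v.1 ∈ O} := by
  ext e
  induction e using Sym2.ind with
  | h a b =>
    rw [mem_finsetRestrict_iff, edgeLift_mk, mk_mem_thin_iff, mk_mem_thin_iff,
      mem_finsetRestrict_iff, edgeLift_mk, finsetIncl_coe, finsetIncl_coe]

/-- **Ghost-wired thinned connections restrict to sub-pieces** (`ghostConn_finsetRestrict`, i.e.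
Grimmett 2006, Lemma (4.13), applied to the thinned configuration, whose restriction is the thinned
restriction): for `Λ ⊆ Δ` with `∂Λ ≠ ∅` unless `Δ = Λ`, probes inside `Λ` or meeting `∂Λ`, and
`ω ⊆ E_Δ`, if some `x ∈ A`, `y ∈ B` of `Δ` are joined by thinned open edges and wired pairs of `∂Δ`,
then some `x ∈ A`, `y ∈ B` of `Λ` are joined by thinned open edges of the restriction and wired
pairs of `∂Λ`. [cite: Grimmett2006, Lemma (4.13)] -/
theorem ghostThinConn_finsetRestrict {Λ Δ : Finset (Site d)} (h : Λ ⊆ Δ)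
    (hW' : (∃ v : ↥Δ, v.1 ∉ Λ) → (innerBoundary (zdGraph d) Λ).Nonempty)
    {ω : BondConfig ↥Δ} (hω : ω ⊆ (finsetGraph (zdGraph d) Δ).edgeSet) {A B O : Set (Site d)}
    (hA : (∀ x ∈ A, x ∈ Λ) ∨ ∃ a : ↥Λ, a.1 ∈ A ∧ a.1 ∈ innerBoundary (zdGraph d) Λ)
    (hB : (∀ x ∈ B, x ∈ Λ) ∨ ∃ a : ↥Λ, a.1 ∈ B ∧ a.1 ∈ innerBoundary (zdGraph d) Λ)
    (hc : ∃ x y : ↥Δ, x.1 ∈ A ∧ y.1 ∈ B ∧ (openGraph (ω ∩ {e : Sym2 ↥Δ | ∀ v ∈ e, v.1 ∈ O}) ⊔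
      wired (wiredBoundary (zdGraph d) Δ)).Reachable x y) :
    ∃ x y : ↥Λ, x.1 ∈ A ∧ y.1 ∈ B ∧
      (openGraph (finsetRestrict h ω ∩ {e : Sym2 ↥Λ | ∀ v ∈ e, v.1 ∈ O}) ⊔
        wired (wiredBoundary (zdGraph d) Λ)).Reachable x y := by
  have h1 := ghostConn_finsetRestrict h hW' (Set.inter_subset_left.trans hω) hA hB hc
  rw [finsetRestrict_thin] at h1
  exact h1

end Thin

/-! ### Ghost-wired thinned connection events of boxes are antitone in the box -/

section Boxes

/-- **Ghost probabilities of thinned queries decrease with the box** (Grimmett 2006, Thm. (4.19)(a),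
proof, eq. (4.24), with the event inclusion of Lemma (4.13)): for `M ≤ L`, `d ≥ 1`, `0 ≤ p ≤ 1`,
`q ≥ 1`, a finite set `T` of queries whose probes are each inside `Λ_M` or meet `∂Λ_M`, the
`φ¹_{Λ_L}`-probability that all queries of `T` hold ghost-wired (connection by thinned open edges and
wired pairs of `∂Λ_L`) is at most the `φ¹_{Λ_M}`-probability of the same for `Λ_M`: the events are
increasing and restrict to the sub-box. [cite: Grimmett2006, Thm. (4.19)(a), proof, eq. (4.24)] -/
theorem rcMeasure_real_ghostThinConnEvent_box_anti (hd : 0 < d) {M L : ℕ} (hML : M ≤ L) {p q : ℝ}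
    (hp : p ∈ Set.Icc (0 : ℝ) 1) (hq : 1 ≤ q) {ι : Type*} (A B O : ι → Set (Site d)) (T : Finset ι)
    (hadmA : ∀ i ∈ T, (∀ x ∈ A i, x ∈ box d M) ∨
      ∃ z : BoxV d M, z.1 ∈ A i ∧ z.1 ∈ innerBoundary (zdGraph d) (box d M))
    (hadmB : ∀ i ∈ T, (∀ x ∈ B i, x ∈ box d M) ∨
      ∃ z : BoxV d M, z.1 ∈ B i ∧ z.1 ∈ innerBoundary (zdGraph d) (box d M)) :
    (rcMeasure (boxGraph d L) p q (boxBoundary d L)).real {ω | ∀ i ∈ T, ∃ x y : BoxV d L,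
        x.1 ∈ A i ∧ y.1 ∈ B i ∧ (openGraph (ω ∩ {e : Sym2 (BoxV d L) | ∀ v ∈ e, v.1 ∈ O i}) ⊔
          wired (boxBoundary d L)).Reachable x y} ≤
      (rcMeasure (boxGraph d M) p q (boxBoundary d M)).real {ξ | ∀ i ∈ T, ∃ x y : BoxV d M,
        x.1 ∈ A i ∧ y.1 ∈ B i ∧ (openGraph (ξ ∩ {e : Sym2 (BoxV d M) | ∀ v ∈ e, v.1 ∈ O i}) ⊔
          wired (boxBoundary d M)).Reachable x y} := by
  have hq0 : 0 < q := one_pos.trans_le hq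
  have hW' : (∃ v : BoxV d L, v.1 ∉ box d M) → (innerBoundary (zdGraph d) (box d M)).Nonempty :=
    fun _ => innerBoundary_box_nonempty hd M
  calc _ ≤ (rcMeasure (boxGraph d L) p q (boxBoundary d L)).real (finsetRestrict (box_mono d hML) ⁻¹'
          {ξ | ∀ i ∈ T, ∃ x y : BoxV d M, x.1 ∈ A i ∧ y.1 ∈ B i ∧
            (openGraph (ξ ∩ {e : Sym2 (BoxV d M) | ∀ v ∈ e, v.1 ∈ O i}) ⊔
              wired (boxBoundary d M)).Reachable x y}) :=
        rcMeasure_real_mono_on_edgeSets _ hp hq0 _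
          (fun ω hω (hmem : ∀ i ∈ T, ∃ x y : BoxV d L, x.1 ∈ A i ∧ y.1 ∈ B i ∧
              (openGraph (ω ∩ {e : Sym2 (BoxV d L) | ∀ v ∈ e, v.1 ∈ O i}) ⊔
                wired (boxBoundary d L)).Reachable x y) =>
            Set.mem_preimage.2 fun i hi =>
              ghostThinConn_finsetRestrict (box_mono d hML) hW' hω (hadmA i hi) (hadmB i hi)
                (hmem i hi))
    _ ≤ _ := rcMeasure_real_box_restrict_le hd hML hp hq (by
          rintro ξ ξ' hle hξ i hi
          obtain ⟨x, y, hx, hy, hxy⟩ := hξ i hi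
          exact ⟨x, y, hx, hy, hxy.mono
            (sup_le_sup_right (fromEdgeSet_mono (Set.inter_subset_inter_left _ hle)) _)⟩)

/-! ### Admissibility of finite / co-finite probes in large boxes; arms -/

/-- The inner boundary of `Λ_L` avoids `Λ_r` for `L > r`. [folklore] -/
theorem notMem_box_of_mem_innerBoundary_box {L r : ℕ} (hL : r < L) {y : Site d}
    (hy : y ∈ innerBoundary (zdGraph d) (box d L)) : y ∉ box d r := by
  rw [box_eq_icc_shift_zero] at hy
  have hyS : y ∈ Finset.Icc (fun i => -((L : ℕ) : ℤ) + (0 : Site d) i)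
      (fun i => ((L : ℕ) : ℤ) + (0 : Site d) i) := (mem_innerBoundary_iff.1 hy).1
  have hsr0 : siteRad (0 : Site d) = 0 := by simp [siteRad]
  exact notMem_box_of_mem_wiredBoundary_icc_shift (v := (0 : Site d)) (b := ⟨y, hyS⟩)
    (by rw [hsr0]; omega) ((mem_wiredBoundary_iff _).2 hy)

/-- **Admissibility of the probes in large boxes**: if `K ⊆ Λ_r` or `ℤ^d ∖ Λ_r ⊆ K`, then for
`L > r` the probe `K` is inside `Λ_L` or meets its inner boundary. [folklore] -/
theorem probe_adm_box (hd : 0 < d) {K : Set (Site d)} {r : ℕ}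
    (hK : K ⊆ ↑(box d r) ∨ Kᶜ ⊆ ↑(box d r)) {L : ℕ} (hL : r < L) :
    (∀ x ∈ K, x ∈ box d L) ∨
      ∃ z : BoxV d L, z.1 ∈ K ∧ z.1 ∈ innerBoundary (zdGraph d) (box d L) := by
  have hsr0 : siteRad (0 : Site d) = 0 := by simp [siteRad]
  rcases probe_adm_icc_shift hd hK (0 : Site d) (L := L) (by rw [hsr0]; omega) with
    h1 | ⟨z, hzK, hz⟩
  · left
    intro x hx
    rw [box_eq_icc_shift_zero]
    exact h1 x hx
  · right
    have hz1 : z.1 ∈ box d L := by rw [box_eq_icc_shift_zero]; exact z.2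
    have hz2 : z.1 ∈ innerBoundary (zdGraph d) (box d L) := by
      rw [box_eq_icc_shift_zero]; exact hz
    exact ⟨⟨z.1, hz1⟩, hzK, hz2⟩

/-- A finite family of probes, each finite or co-finite, has a common radius `r`: every probe is
inside `Λ_r` or contains `ℤ^d ∖ Λ_r` (as `exists_probeRadius`, for any finite index type).
[folklore] -/
theorem exists_probeRadius' {ι : Type*} [Finite ι] {K : ι → Set (Site d)}
    (hK : ∀ i, (K i).Finite ∨ (K i)ᶜ.Finite) :
    ∃ r : ℕ, ∀ i, K i ⊆ ↑(box d r) ∨ (K i)ᶜ ⊆ ↑(box d r) := by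
  have h1 : ∀ i, ∃ r : ℕ, K i ⊆ ↑(box d r) ∨ (K i)ᶜ ⊆ ↑(box d r) := fun i =>
    (hK i).elim (fun h => (exists_subset_box_of_set_finite h).imp fun _ hr => Or.inl hr)
      (fun h => (exists_subset_box_of_set_finite h).imp fun _ hr => Or.inr hr)
  choose r hr using h1
  haveI := Fintype.ofFinite ι
  refine ⟨Finset.univ.sup r, fun i => ?_⟩
  have hi : (↑(box d (r i)) : Set (Site d)) ⊆ ↑(box d (Finset.univ.sup r)) :=
    Finset.coe_subset.2 (box_mono d (Finset.le_sup (f := r) (Finset.mem_univ i)))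
  exact (hr i).imp (fun h' => h'.trans hi) (fun h' => h'.trans hi)

/-- The arm probability of a lattice point depends on the piece only through its value (transport
along an equality of finsets, to pass between `Λ_L` and `Λ_L + 0`). [folklore] -/
theorem siteArm_congr_dom {S S' : Finset (Site d)} (h : S = S') (p q : ℝ) (x : Site d) :
    (rcMeasure (finsetGraph (zdGraph d) S) p q (wiredBoundary (zdGraph d) S)).real
        {ω | ∃ a y : ↥S, a.1 = x ∧ y ∈ wiredBoundary (zdGraph d) S ∧ (openGraph ω).Reachable a y} =
      (rcMeasure (finsetGraph (zdGraph d) S') p q (wiredBoundary (zdGraph d) S')).real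
        {ω | ∃ a y : ↥S', a.1 = x ∧ y ∈ wiredBoundary (zdGraph d) S' ∧
          (openGraph ω).Reachable a y} := by
  subst h
  rfl

/-- **The critical arm probabilities of fixed lattice points vanish along the centred boxes**
(`tendsto_rcMeasure_real_siteArm_criticalBeta` at `v = 0`): `φ¹_{Λ_L}(x ↔ ∂Λ_L) → 0`, `d ≥ 3`.
[cite: AizenmanDuminilCopinSidoraviciusCMP2015, Thm. 1.2 with Cor. 1.5 (1)] -/
theorem tendsto_rcMeasure_real_siteArm_box_criticalBeta (hd : 3 ≤ d) (x : Site d) :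
    Tendsto (fun L : ℕ => (rcMeasure (boxGraph d L) (fkIsingParam (criticalBeta d)) 2
      (boxBoundary d L)).real {ω | ∃ a y : BoxV d L, a.1 = x ∧ y ∈ boxBoundary d L ∧
        (openGraph ω).Reachable a y}) atTop (𝓝 0) := by
  refine (tendsto_rcMeasure_real_siteArm_criticalBeta hd 0 x).congr fun L => ?_
  exact (siteArm_congr_dom (box_eq_icc_shift_zero L) _ _ x).symm

/-! ### Convergence of the ghost probabilities; the ghost correction is a union of arm events -/

/-- **The ghost probabilities of thinned queries converge along the boxes** (Grimmett 2006, proof of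
Thm. (4.19)(a): the sequence is non-increasing for `L > r` by
`rcMeasure_real_ghostThinConnEvent_box_anti`, and bounded below): `d ≥ 1`, `0 ≤ p ≤ 1`, `q ≥ 1`,
probes each finite or co-finite. [cite: Grimmett2006, Thm. (4.19), proof] -/
theorem tendsto_rcMeasure_real_ghostThinConnEvent (hd : 0 < d) {p q : ℝ}
    (hp : p ∈ Set.Icc (0 : ℝ) 1) (hq : 1 ≤ q) {ι : Type*} [Finite ι] {A B : ι → Set (Site d)}
    (O : ι → Set (Site d)) (hA : ∀ i, (A i).Finite ∨ (A i)ᶜ.Finite)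
    (hB : ∀ i, (B i).Finite ∨ (B i)ᶜ.Finite) (T : Finset ι) :
    ∃ ℓ : ℝ, Tendsto (fun L : ℕ => (rcMeasure (boxGraph d L) p q (boxBoundary d L)).real
      {ω | ∀ i ∈ T, ∃ x y : BoxV d L, x.1 ∈ A i ∧ y.1 ∈ B i ∧
        (openGraph (ω ∩ {e : Sym2 (BoxV d L) | ∀ v ∈ e, v.1 ∈ O i}) ⊔
          wired (boxBoundary d L)).Reachable x y}) atTop (𝓝 ℓ) := by
  obtain ⟨rA, hrA⟩ := exists_probeRadius' hA
  obtain ⟨rB, hrB⟩ := exists_probeRadius' hB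
  set r := max rA rB with hr
  set g : ℕ → ℝ := fun L => (rcMeasure (boxGraph d L) p q (boxBoundary d L)).real
      {ω | ∀ i ∈ T, ∃ x y : BoxV d L, x.1 ∈ A i ∧ y.1 ∈ B i ∧
        (openGraph (ω ∩ {e : Sym2 (BoxV d L) | ∀ v ∈ e, v.1 ∈ O i}) ⊔
          wired (boxBoundary d L)).Reachable x y}
  have hboxA : ∀ i, A i ⊆ ↑(box d r) ∨ (A i)ᶜ ⊆ ↑(box d r) := fun i =>
    (hrA i).imp (fun h' => h'.trans (Finset.coe_subset.2 (box_mono d (le_max_left _ _))))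
      (fun h' => h'.trans (Finset.coe_subset.2 (box_mono d (le_max_left _ _))))
  have hboxB : ∀ i, B i ⊆ ↑(box d r) ∨ (B i)ᶜ ⊆ ↑(box d r) := fun i =>
    (hrB i).imp (fun h' => h'.trans (Finset.coe_subset.2 (box_mono d (le_max_right _ _))))
      (fun h' => h'.trans (Finset.coe_subset.2 (box_mono d (le_max_right _ _))))
  have hanti : ∀ M L : ℕ, r < M → M ≤ L → g L ≤ g M := fun M L hM hML =>
    rcMeasure_real_ghostThinConnEvent_box_anti hd hML hp hq A B O T
      (fun i _ => probe_adm_box hd (hboxA i) hM) (fun i _ => probe_adm_box hd (hboxB i) hM)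
  have htail : Antitone fun n : ℕ => g (n + (r + 1)) := fun n n' hnn' =>
    hanti _ _ (by omega) (by omega)
  have hbdd : BddBelow (Set.range fun n : ℕ => g (n + (r + 1))) :=
    ⟨0, by rintro _ ⟨n, rfl⟩; exact measureReal_nonneg⟩
  exact ⟨⨅ n : ℕ, g (n + (r + 1)),
    (tendsto_add_atTop_iff_nat (r + 1)).1 (tendsto_atTop_ciInf htail hbdd)⟩

/-- **The ghost correction is a finite union of arm events**: in `Λ_L` with `L > r`, if every query of
`T` holds ghost-wired but some query does not hold, then some lattice point of `Λ_r` is joined to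
`∂Λ_L` by an open path — a finite first probe lies in `Λ_r` (cut the path at its first wired step;
a thinned open path is open), and a co-finite first probe contains `∂Λ_L` (cut at the last wired
step). [cite: Grimmett2006, Thm. (4.19), proof] -/
theorem ghostThinConnEvent_diff_thinConnEvent_subset {ι : Type*} {A : ι → Set (Site d)}
    (B O : ι → Set (Site d)) {r : ℕ} (hr : ∀ i, A i ⊆ ↑(box d r) ∨ (A i)ᶜ ⊆ ↑(box d r)) {L : ℕ}
    (hL : r < L) (T : Finset ι) :
    {ω : BondConfig (BoxV d L) | ∀ i ∈ T, ∃ x y : BoxV d L, x.1 ∈ A i ∧ y.1 ∈ B i ∧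
        (openGraph (ω ∩ {e : Sym2 (BoxV d L) | ∀ v ∈ e, v.1 ∈ O i}) ⊔
          wired (boxBoundary d L)).Reachable x y} \
        {ω | ∀ i ∈ T, ∃ x y : BoxV d L, x.1 ∈ A i ∧ y.1 ∈ B i ∧
          (openGraph (ω ∩ {e : Sym2 (BoxV d L) | ∀ v ∈ e, v.1 ∈ O i})).Reachable x y} ⊆
      ⋃ x ∈ box d r, {ω | ∃ a y : BoxV d L, a.1 = x ∧ y ∈ boxBoundary d L ∧
        (openGraph ω).Reachable a y} := by
  rintro ω ⟨hg, hn⟩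
  simp only [Set.mem_setOf_eq, not_forall] at hn
  obtain ⟨i, hi, hn⟩ := hn
  have hg' := hg i hi
  rcases hr i with hfin | hcof
  · obtain ⟨x, hx, b, hb, hxb⟩ := exists_siteArm_of_ghostConn
      (ω := ω ∩ {e : Sym2 (BoxV d L) | ∀ v ∈ e, v.1 ∈ O i}) (A := {x : BoxV d L | x.1 ∈ A i})
      (A' := {y : BoxV d L | y.1 ∈ B i}) hg' hn
    exact Set.mem_iUnion₂.2 ⟨x.1, hfin hx, x, b, rfl, hb,
      hxb.mono (fromEdgeSet_mono Set.inter_subset_left)⟩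
  · refine (not_wired_subset_of_ghostConn (ω := ω ∩ {e : Sym2 (BoxV d L) | ∀ v ∈ e, v.1 ∈ O i})
      (A := {x : BoxV d L | x.1 ∈ A i}) (A' := {y : BoxV d L | y.1 ∈ B i}) hg' hn
      fun b hb => ?_).elim
    by_contra hbK
    exact notMem_box_of_mem_innerBoundary_box hL hb (hcof hbK)

/-! ### Convergence of the thinned connection events, of the atoms, of the law -/

/-- **The thinned connection events converge along the boxes** (`p = 1 - e^{-2β_c(d)}`, `q = 2`,
`d ≥ 3`): the ghost-wired probabilities converge and the ghost correction is at most
`∑_{x ∈ Λ_r} φ¹_{Λ_L}(x ↔ ∂Λ_L) → 0`. [cite: Grimmett2006, Thm. (4.19), proof] -/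
theorem tendsto_rcMeasure_real_thinConnEvent_criticalBeta (hd : 3 ≤ d) {ι : Type*} [Finite ι]
    {A B : ι → Set (Site d)} (O : ι → Set (Site d))
    (hA : ∀ i, (A i).Finite ∨ (A i)ᶜ.Finite) (hB : ∀ i, (B i).Finite ∨ (B i)ᶜ.Finite)
    (T : Finset ι) :
    ∃ ℓ : ℝ, Tendsto (fun L : ℕ => (rcMeasure (boxGraph d L) (fkIsingParam (criticalBeta d)) 2
      (boxBoundary d L)).real {ω | ∀ i ∈ T, ∃ x y : BoxV d L, x.1 ∈ A i ∧ y.1 ∈ B i ∧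
        (openGraph (ω ∩ {e : Sym2 (BoxV d L) | ∀ v ∈ e, v.1 ∈ O i})).Reachable x y})
      atTop (𝓝 ℓ) := by
  have hd0 : 0 < d := by omega
  have hp : fkIsingParam (criticalBeta d) ∈ Set.Icc (0 : ℝ) 1 :=
    fkIsingParam_mem_Icc (criticalBeta_nonneg d)
  obtain ⟨ℓ, hℓ⟩ := tendsto_rcMeasure_real_ghostThinConnEvent hd0 hp one_le_two O hA hB T
  obtain ⟨r, hr⟩ := exists_probeRadius' hA
  refine ⟨ℓ, ?_⟩
  -- the wired critical box measure, the ghost-wired and the plain events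
  set μ : (L : ℕ) → Measure (BondConfig (BoxV d L)) := fun L =>
    rcMeasure (boxGraph d L) (fkIsingParam (criticalBeta d)) 2 (boxBoundary d L) with hμ
  set GE : (L : ℕ) → Set (BondConfig (BoxV d L)) := fun L =>
    {ω | ∀ i ∈ T, ∃ x y : BoxV d L, x.1 ∈ A i ∧ y.1 ∈ B i ∧
      (openGraph (ω ∩ {e : Sym2 (BoxV d L) | ∀ v ∈ e, v.1 ∈ O i}) ⊔
        wired (boxBoundary d L)).Reachable x y} with hGE
  set CE : (L : ℕ) → Set (BondConfig (BoxV d L)) := fun L =>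
    {ω | ∀ i ∈ T, ∃ x y : BoxV d L, x.1 ∈ A i ∧ y.1 ∈ B i ∧
      (openGraph (ω ∩ {e : Sym2 (BoxV d L) | ∀ v ∈ e, v.1 ∈ O i})).Reachable x y} with hCE
  have hprob : ∀ L, IsProbabilityMeasure (μ L) := fun L =>
    isProbabilityMeasure_rcMeasure _ hp two_pos _
  -- the ghost correction vanishes
  have hdiff : Tendsto (fun L : ℕ => (μ L).real (GE L \ CE L)) atTop (𝓝 0) := by
    have hsum : Tendsto (fun L : ℕ => ∑ x ∈ box d r, (μ L).real {ω | ∃ a y : BoxV d L, a.1 = x ∧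
        y ∈ boxBoundary d L ∧ (openGraph ω).Reachable a y}) atTop (𝓝 0) := by
      have h := tendsto_finsetSum (box d r) fun x (_ : x ∈ box d r) =>
        tendsto_rcMeasure_real_siteArm_box_criticalBeta hd x
      simp only [Finset.sum_const_zero] at h
      exact h
    refine squeeze_zero' (Eventually.of_forall fun L => measureReal_nonneg) ?_ hsum
    filter_upwards [eventually_gt_atTop r] with L hL
    haveI := hprob L
    exact (measureReal_mono (ghostThinConnEvent_diff_thinConnEvent_subset B O hr hL T)
      (measure_ne_top _ _)).trans (measureReal_biUnion_finset_le _ _)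
  -- `φ(open event) = φ(ghost event) - φ(ghost ∖ open)`
  have hkey : ∀ L : ℕ, (μ L).real (CE L) = (μ L).real (GE L) - (μ L).real (GE L \ CE L) := by
    intro L
    haveI := hprob L
    have h1 := measureReal_inter_add_sdiff (μ := μ L) (s := GE L) (t := CE L)
      (Set.toFinite _).measurableSet
    have hsub : CE L ⊆ GE L := by
      rintro ω hω i hi
      obtain ⟨x, y, hx, hy, hxy⟩ := hω i hi
      exact ⟨x, y, hx, hy, hxy.mono le_sup_left⟩
    rw [Set.inter_eq_right.2 hsub] at h1
    linarith
  rw [show (fun L : ℕ => (μ L).real (CE L)) =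
      fun L : ℕ => (μ L).real (GE L) - (μ L).real (GE L \ CE L) from funext hkey]
  have h := hℓ.sub hdiff
  rw [sub_zero] at h
  exact h

/-- **The atoms converge**: for finite sets `S₀, T` of queries, the probability that every query of
`S₀` holds and no query of `T` holds converges along the boxes (induction on `T`:
`φ(E ∖ C) = φ(E) - φ(E ∩ C)`). [cite: Grimmett2006, Thm. (4.19), proof] -/
theorem tendsto_rcMeasure_real_thinConnAtom_criticalBeta (hd : 3 ≤ d) {ι : Type*} [Finite ι]
    [DecidableEq ι] {A B : ι → Set (Site d)} (O : ι → Set (Site d))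
    (hA : ∀ i, (A i).Finite ∨ (A i)ᶜ.Finite) (hB : ∀ i, (B i).Finite ∨ (B i)ᶜ.Finite)
    (T : Finset ι) :
    ∀ S₀ : Finset ι, ∃ ℓ : ℝ, Tendsto (fun L : ℕ => (rcMeasure (boxGraph d L)
      (fkIsingParam (criticalBeta d)) 2 (boxBoundary d L)).real
        {ω | (∀ i ∈ S₀, ∃ x y : BoxV d L, x.1 ∈ A i ∧ y.1 ∈ B i ∧
            (openGraph (ω ∩ {e : Sym2 (BoxV d L) | ∀ v ∈ e, v.1 ∈ O i})).Reachable x y) ∧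
          ∀ i ∈ T, ¬ ∃ x y : BoxV d L, x.1 ∈ A i ∧ y.1 ∈ B i ∧
            (openGraph (ω ∩ {e : Sym2 (BoxV d L) | ∀ v ∈ e, v.1 ∈ O i})).Reachable x y})
      atTop (𝓝 ℓ) := by
  have hp : fkIsingParam (criticalBeta d) ∈ Set.Icc (0 : ℝ) 1 :=
    fkIsingParam_mem_Icc (criticalBeta_nonneg d)
  induction T using Finset.induction_on with
  | empty =>
    intro S₀
    obtain ⟨ℓ, hℓ⟩ := tendsto_rcMeasure_real_thinConnEvent_criticalBeta hd O hA hB S₀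
    refine ⟨ℓ, hℓ.congr fun L => congrArg _ (Set.ext fun ω => ?_)⟩
    exact ⟨fun h => ⟨h, fun i hi => absurd hi (Finset.notMem_empty i)⟩, fun h => h.1⟩
  | insert a T haT ih =>
    intro S₀
    obtain ⟨ℓ₁, h₁⟩ := ih S₀
    obtain ⟨ℓ₂, h₂⟩ := ih (insert a S₀)
    refine ⟨ℓ₁ - ℓ₂, (h₁.sub h₂).congr fun L => ?_⟩
    -- the connection statement of the query `i` in `Λ_L`
    set Q : ι → BondConfig (BoxV d L) → Prop := fun i ω => ∃ x y : BoxV d L, x.1 ∈ A i ∧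
      y.1 ∈ B i ∧ (openGraph (ω ∩ {e : Sym2 (BoxV d L) | ∀ v ∈ e, v.1 ∈ O i})).Reachable x y
      with hQ
    haveI : IsProbabilityMeasure (rcMeasure (boxGraph d L) (fkIsingParam (criticalBeta d)) 2
        (boxBoundary d L)) :=
      isProbabilityMeasure_rcMeasure _ hp two_pos _
    have hkey := measureReal_inter_add_sdiff
      (μ := rcMeasure (boxGraph d L) (fkIsingParam (criticalBeta d)) 2 (boxBoundary d L))
      (s := {ω | (∀ i ∈ S₀, Q i ω) ∧ ∀ i ∈ T, ¬ Q i ω}) (t := {ω | Q a ω})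
      (Set.toFinite _).measurableSet
    have hinter : {ω | (∀ i ∈ S₀, Q i ω) ∧ ∀ i ∈ T, ¬ Q i ω} ∩ {ω | Q a ω} =
        {ω | (∀ i ∈ insert a S₀, Q i ω) ∧ ∀ i ∈ T, ¬ Q i ω} := by
      ext ω
      simp only [Set.mem_inter_iff, Set.mem_setOf_eq, Finset.forall_mem_insert]
      tauto
    have hdiff : {ω | (∀ i ∈ S₀, Q i ω) ∧ ∀ i ∈ T, ¬ Q i ω} \ {ω | Q a ω} =
        {ω | (∀ i ∈ S₀, Q i ω) ∧ ∀ i ∈ insert a T, ¬ Q i ω} := by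
      ext ω
      simp only [Set.mem_sdiff, Set.mem_setOf_eq, Finset.forall_mem_insert]
      tauto
    rw [hinter, hdiff] at hkey
    linarith

/-- **The law of the answers is a sum over its atoms**: the answer function `i ↦ (query i holds)` is
determined, by function and propositional extensionality, by the finite set of queries that hold,
so `{answers ∈ R}` is the disjoint union over the admissible patterns `S₀` of the atoms
`{pattern = S₀}` (any finite measure, any piece `S`). [folklore] -/
theorem measureReal_thinConnLaw_eq_sum {S : Finset (Site d)} (μ : Measure (BondConfig ↥S))
    [IsFiniteMeasure μ] {ι : Type*} [Fintype ι] [DecidableEq ι] (A B O : ι → Set (Site d))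
    (R : Set (ι → Prop)) [DecidablePred fun S₀ : Finset ι => (fun i => i ∈ S₀) ∈ R] :
    μ.real {ω | (fun i => ∃ x y : ↥S, x.1 ∈ A i ∧ y.1 ∈ B i ∧
        (openGraph (ω ∩ {e : Sym2 ↥S | ∀ v ∈ e, v.1 ∈ O i})).Reachable x y) ∈ R} =
      ∑ S₀ ∈ Finset.univ.filter (fun S₀ : Finset ι => (fun i => i ∈ S₀) ∈ R),
        μ.real {ω | (∀ i ∈ S₀, ∃ x y : ↥S, x.1 ∈ A i ∧ y.1 ∈ B i ∧
            (openGraph (ω ∩ {e : Sym2 ↥S | ∀ v ∈ e, v.1 ∈ O i})).Reachable x y) ∧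
          ∀ i ∈ Finset.univ \ S₀, ¬ ∃ x y : ↥S, x.1 ∈ A i ∧ y.1 ∈ B i ∧
            (openGraph (ω ∩ {e : Sym2 ↥S | ∀ v ∈ e, v.1 ∈ O i})).Reachable x y} := by
  classical
  -- the connection statement of the query `i` in `S`
  set Q : ι → BondConfig ↥S → Prop := fun i ω => ∃ x y : ↥S, x.1 ∈ A i ∧ y.1 ∈ B i ∧
    (openGraph (ω ∩ {e : Sym2 ↥S | ∀ v ∈ e, v.1 ∈ O i})).Reachable x y with hQ
  -- the pattern of a configuration: the set of queries that hold
  set f : BondConfig ↥S → Finset ι := fun ω => Finset.univ.filter fun i => Q i ω with hf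
  have hpre : {ω : BondConfig ↥S | (fun i => Q i ω) ∈ R} =
      f ⁻¹' ↑(Finset.univ.filter fun S₀ : Finset ι => (fun i => i ∈ S₀) ∈ R) := by
    ext ω
    have hfun : (fun i => i ∈ f ω) = fun i => Q i ω := by
      funext i
      simp only [hf, Finset.mem_filter, Finset.mem_univ, true_and]
    simp only [Set.mem_setOf_eq, Set.mem_preimage, Finset.mem_coe, Finset.mem_filter,
      Finset.mem_univ, true_and, hfun]
  have hfib : ∀ S₀ : Finset ι, f ⁻¹' {S₀} =
      {ω | (∀ i ∈ S₀, Q i ω) ∧ ∀ i ∈ Finset.univ \ S₀, ¬ Q i ω} := by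
    intro S₀
    ext ω
    simp only [Set.mem_preimage, Set.mem_singleton_iff, Set.mem_setOf_eq, hf, Finset.ext_iff,
      Finset.mem_filter, Finset.mem_univ, true_and, Finset.mem_sdiff]
    constructor
    · intro h
      exact ⟨fun i hi => (h i).2 hi, fun i hi hc => hi ((h i).1 hc)⟩
    · rintro ⟨h1, h2⟩ i
      exact ⟨fun hc => by_contra fun hi => h2 i hi hc, h1 i⟩
  show μ.real {ω : BondConfig ↥S | (fun i => Q i ω) ∈ R} =
    ∑ S₀ ∈ Finset.univ.filter (fun S₀ : Finset ι => (fun i => i ∈ S₀) ∈ R),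
      μ.real {ω | (∀ i ∈ S₀, Q i ω) ∧ ∀ i ∈ Finset.univ \ S₀, ¬ Q i ω}
  rw [hpre, ← sum_measureReal_preimage_singleton _ (fun S₀ _ => (Set.toFinite _).measurableSet)]
  exact Finset.sum_congr rfl fun S₀ _ => by rw [hfib]

/-- **Thermodynamic limit of the thinned connection laws along boxes** (the wired, critical,
`d ≥ 3` instance of Grimmett 2006, Thm. (4.19) for these events): for `p = 1 - e^{-2β_c(d)}`,
`q = 2`, `d ≥ 3`, finitely many queries `(A i, B i, O i)` with `A i`, `B i` each finite or co-finite
and `O i` arbitrary, and every set `R` of answer functions, the `φ¹_{Λ_L}`-probability that the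
answers `i ↦ (some x ∈ A i, y ∈ B i of Λ_L are joined by an open path of Λ_L through vertices of
O i)` lie in `R` converges as `L → ∞`. [cite: Grimmett2006, Thm. (4.19), proof] -/
theorem tendsto_rcMeasure_real_thinConnLaw_criticalBeta (hd : 3 ≤ d) {ι : Type*} [Fintype ι]
    {A B : ι → Set (Site d)} (O : ι → Set (Site d))
    (hA : ∀ i, (A i).Finite ∨ (A i)ᶜ.Finite) (hB : ∀ i, (B i).Finite ∨ (B i)ᶜ.Finite)
    (R : Set (ι → Prop)) :
    ∃ ℓ : ℝ, Tendsto (fun L : ℕ => (rcMeasure (boxGraph d L) (fkIsingParam (criticalBeta d)) 2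
      (boxBoundary d L)).real {ω | (fun i => ∃ x y : BoxV d L, x.1 ∈ A i ∧ y.1 ∈ B i ∧
        (openGraph (ω ∩ {e : Sym2 (BoxV d L) | ∀ v ∈ e, v.1 ∈ O i})).Reachable x y) ∈ R})
      atTop (𝓝 ℓ) := by
  classical
  have hp : fkIsingParam (criticalBeta d) ∈ Set.Icc (0 : ℝ) 1 :=
    fkIsingParam_mem_Icc (criticalBeta_nonneg d)
  have hatom := fun S₀ : Finset ι =>
    tendsto_rcMeasure_real_thinConnAtom_criticalBeta hd O hA hB (Finset.univ \ S₀) S₀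
  choose ℓ hℓ using hatom
  refine ⟨∑ S₀ ∈ Finset.univ.filter (fun S₀ : Finset ι => (fun i => i ∈ S₀) ∈ R), ℓ S₀, ?_⟩
  refine (tendsto_finsetSum _ fun S₀ _ => hℓ S₀).congr fun L => ?_
  haveI : IsProbabilityMeasure (rcMeasure (boxGraph d L) (fkIsingParam (criticalBeta d)) 2
      (boxBoundary d L)) :=
    isProbabilityMeasure_rcMeasure _ hp two_pos _
  exact (measureReal_thinConnLaw_eq_sum _ A B O R).symm

end Boxes

end Literature.Probability.LatticeModels
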